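import Literature.Probability.RandomPlanarGeometry.HexSAWBrickWallSlabFugacity
import Mathlib.Analysis.MeanInequalities
import HarnessLib

/-!
# `μ_H(y)` of the armchair slabs is non-decreasing and log-convex in the surface fugacity (Beaton 2014, Proposition 8)

Topic `Literature/Probability/RandomPlanarGeometry` (continues `HexSAWBrickWallSlabFugacity.lean` — `HexBW.slabZ H n y
= Ĉ_{H,n}(y,1)`, `HexBW.slabMuY H y`, `Ĉ_{H,n}(y)^{1/n} → μ_H(y)` for `H ≥ 1`; armchair twin of
`HexSAWBrickWallStripFugacityConvex.lean`).  Source: N. R. Beaton, *J. Phys. A* 47 (2014) 075003, arXiv:1210.0274v3, §3.2,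
Proposition 8 (p. 15): "`μ_T(y,z)` is finite and non-decreasing in `y` and `z` … `μ_T(1,y)` is log-convex and thus is a
continuous function of `log y`" (there "easily adapted from [vanRensburg2006Selfavoiding]").  Here: monotonicity term by
term, log-convexity by Hölder on the finite sums, then the Fekete limit.

## Statements (namespace `Literature.Probability.RandomPlanarGeometry.SAW.HexBW`, all PROVED; `H ≥ 1` for the growth rates)

* `slabZ_mono_y`, **`slabMuY_mono_y`**; `slabZ_holder`, **`slabMuY_logConvex`** — `μ_H(y₁^θ y₂^{1−θ}) ≤ μ_H(y₁)^θ μ_H(y₂)^{1−θ}`.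
-/

noncomputable section

open Filter Topology Finset Literature.Probability.LatticeModels Literature.Probability.Percolation

namespace Literature.Probability.RandomPlanarGeometry.SAW.HexBW

/-! ### Monotonicity in `y` -/

/-- `Ĉ_{H,n}(y)` is non-decreasing in `y ≥ 0`. [cite: Beaton2014RotatedHoneycomb, §3.2, Proposition 8 (arXiv:1210.0274v3 p. 15: non-decreasing in y and z)] -/
theorem slabZ_mono_y (H n : ℕ) {y₁ y₂ : ℝ} (hy : 0 ≤ y₁) (h : y₁ ≤ y₂) : slabZ H n y₁ ≤ slabZ H n y₂ :=
  Finset.sum_le_sum fun _ _ => pow_le_pow_left₀ hy h _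

/-- **`μ_H(y)` is non-decreasing in `y`.** [cite: Beaton2014RotatedHoneycomb, §3.2, Proposition 8 (arXiv:1210.0274v3 p. 15: "non-decreasing in y and z")] -/
theorem slabMuY_mono_y {H : ℕ} (hH : 1 ≤ H) {y₁ y₂ : ℝ} (hy : 0 < y₁) (h : y₁ ≤ y₂) : slabMuY H y₁ ≤ slabMuY H y₂ := by
  have hy₂ : 0 < y₂ := lt_of_lt_of_le hy h
  refine le_of_tendsto_of_tendsto' (tendsto_slabZ_rpow hH hy) (tendsto_slabZ_rpow hH hy₂) fun n => ?_
  exact Real.rpow_le_rpow (slabZ_pos hH n hy).le (slabZ_mono_y H n hy.le h) (by positivity)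

/-! ### Log-convexity in `log y` -/

/-- **Hölder**: `Ĉ_{H,n}(y₁^θ y₂^{1−θ}) ≤ Ĉ_{H,n}(y₁)^θ · Ĉ_{H,n}(y₂)^{1−θ}` for `0 < θ < 1`.
[cite: Beaton2014RotatedHoneycomb, §3.2, Proposition 8 (arXiv:1210.0274v3 p. 15: log-convexity)] -/
theorem slabZ_holder (H n : ℕ) {y₁ y₂ θ : ℝ} (h₁ : 0 < y₁) (h₂ : 0 < y₂) (hθ0 : 0 < θ) (hθ1 : θ < 1) :
    slabZ H n (y₁ ^ θ * y₂ ^ (1 - θ)) ≤ slabZ H n y₁ ^ θ * slabZ H n y₂ ^ (1 - θ) := by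
  have hθ' : 0 < 1 - θ := by linarith
  -- the two factors of each term
  set f : Site 2 × (ℕ → Site 2) → ℝ := fun p => (y₁ ^ leftVisits p.1 p.2 n) ^ θ with hf
  set g : Site 2 × (ℕ → Site 2) → ℝ := fun p => (y₂ ^ leftVisits p.1 p.2 n) ^ (1 - θ) with hg
  have hf0 : ∀ p, 0 ≤ f p := fun p => Real.rpow_nonneg (pow_nonneg h₁.le _) _
  have hg0 : ∀ p, 0 ≤ g p := fun p => Real.rpow_nonneg (pow_nonneg h₂.le _) _
  -- each term of the left-hand side is `f p * g p`
  have hterm : ∀ p : Site 2 × (ℕ → Site 2),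
      (y₁ ^ θ * y₂ ^ (1 - θ)) ^ leftVisits p.1 p.2 n = f p * g p := by
    intro p
    rw [hf, hg]; simp only
    rw [mul_pow, ← Real.rpow_natCast (y₁ ^ θ), ← Real.rpow_natCast (y₂ ^ (1 - θ)),
      ← Real.rpow_mul h₁.le, ← Real.rpow_mul h₂.le, mul_comm θ, mul_comm (1 - θ),
      Real.rpow_mul h₁.le, Real.rpow_mul h₂.le, Real.rpow_natCast, Real.rpow_natCast]
  -- Hölder with exponents `1/θ`, `1/(1-θ)`
  have hpq : (θ⁻¹).HolderConjugate (1 - θ)⁻¹ := Real.HolderConjugate.inv_one_sub_inv hθ0 hθ1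
  have hH := Real.inner_le_Lp_mul_Lq_of_nonneg (slabPairs H n) (f := f) (g := g) hpq (fun p _ => hf0 p)
    (fun p _ => hg0 p)
  -- simplify the norms: `f^{1/θ} = y₁^V`, `g^{1/(1-θ)} = y₂^V`
  have hfp : ∀ p, f p ^ θ⁻¹ = y₁ ^ leftVisits p.1 p.2 n := fun p => by
    rw [hf]; simp only
    rw [← Real.rpow_mul (pow_nonneg h₁.le _), mul_inv_cancel₀ hθ0.ne', Real.rpow_one]
  have hgq : ∀ p, g p ^ (1 - θ)⁻¹ = y₂ ^ leftVisits p.1 p.2 n := fun p => by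
    rw [hg]; simp only
    rw [← Real.rpow_mul (pow_nonneg h₂.le _), mul_inv_cancel₀ hθ'.ne', Real.rpow_one]
  unfold slabZ
  rw [Finset.sum_congr rfl fun p _ => hterm p]
  rw [Finset.sum_congr rfl fun p _ => hfp p, Finset.sum_congr rfl fun p _ => hgq p, one_div, one_div,
    inv_inv, inv_inv] at hH
  exact hH

/-- **`μ_H(y)` is log-convex in `log y`**: `μ_H(y₁^θ y₂^{1−θ}) ≤ μ_H(y₁)^θ · μ_H(y₂)^{1−θ}` for `0 < θ < 1`.
[cite: Beaton2014RotatedHoneycomb, §3.2, Proposition 8 (arXiv:1210.0274v3 p. 15: "μ_T(1,y) is log-convex and thus is a continuous function of log y")] -/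
theorem slabMuY_logConvex {H : ℕ} (hH : 1 ≤ H) {y₁ y₂ θ : ℝ} (h₁ : 0 < y₁) (h₂ : 0 < y₂) (hθ0 : 0 < θ) (hθ1 : θ < 1) :
    slabMuY H (y₁ ^ θ * y₂ ^ (1 - θ)) ≤ slabMuY H y₁ ^ θ * slabMuY H y₂ ^ (1 - θ) := by
  have hy : 0 < y₁ ^ θ * y₂ ^ (1 - θ) := mul_pos (Real.rpow_pos_of_pos h₁ _) (Real.rpow_pos_of_pos h₂ _)
  have hlim := tendsto_slabZ_rpow hH hy
  have hlim' : Tendsto (fun n : ℕ => (slabZ H n y₁ ^ (1 / (n : ℝ))) ^ θ * (slabZ H n y₂ ^ (1 / (n : ℝ))) ^ (1 - θ))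
      atTop (𝓝 (slabMuY H y₁ ^ θ * slabMuY H y₂ ^ (1 - θ))) :=
    ((tendsto_slabZ_rpow hH h₁).rpow_const (Or.inr hθ0.le)).mul
      ((tendsto_slabZ_rpow hH h₂).rpow_const (Or.inr (by linarith)))
  refine le_of_tendsto_of_tendsto' hlim hlim' fun n => ?_
  have hZ := slabZ_holder H n h₁ h₂ hθ0 hθ1
  have h0 : 0 ≤ slabZ H n (y₁ ^ θ * y₂ ^ (1 - θ)) := (slabZ_pos hH n hy).le
  have hn : 0 ≤ 1 / (n : ℝ) := by positivity
  calc slabZ H n (y₁ ^ θ * y₂ ^ (1 - θ)) ^ (1 / (n : ℝ))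
      ≤ (slabZ H n y₁ ^ θ * slabZ H n y₂ ^ (1 - θ)) ^ (1 / (n : ℝ)) := Real.rpow_le_rpow h0 hZ hn
    _ = (slabZ H n y₁ ^ (1 / (n : ℝ))) ^ θ * (slabZ H n y₂ ^ (1 / (n : ℝ))) ^ (1 - θ) := by
        rw [Real.mul_rpow (Real.rpow_nonneg (slabZ_pos hH n h₁).le _) (Real.rpow_nonneg (slabZ_pos hH n h₂).le _),
          ← Real.rpow_mul (slabZ_pos hH n h₁).le, ← Real.rpow_mul (slabZ_pos hH n h₂).le,
          ← Real.rpow_mul (slabZ_pos hH n h₁).le, ← Real.rpow_mul (slabZ_pos hH n h₂).le, mul_comm θ, mul_comm (1 - θ)]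

end Literature.Probability.RandomPlanarGeometry.SAW.HexBW
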